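import Summits.BirchSwinnertonDyer.BirchSwinnertonDyer.Theorems.ManinLocalTwoThreeStevensCuspInvGaloisAction
import Summits.BirchSwinnertonDyer.BirchSwinnertonDyer.Theorems.ManinLocalTwoThreeComplexAutFixedField
import HarnessLib

/-!
# Stevens 1982 Thm 1.3.1 (a)+(b) in the CYCLOTOMIC form PROVED (`optimalGamma1Parametrization_cuspInv_cyclotomic_galois` holds — T-es-75♭)
(route `ManinLocalTwoThree`, crux C2 `ManinOddAtFour` stmt-BirchSwinnertonDyer-22967; cell bsd-f2-manin, LEAD prover p1 gen 22;
`--supports stmt-BirchSwinnertonDyer-22967`)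

From the `Aut_ℚ(ℂ)` form T-es-75 (`StevensGalois.optimalGamma1Parametrization_cuspInv_galoisAction_holds`, p766724):
(a) RATIONALITY — the value `u(c·{∞,1/y}_f)` of an `X₁(N)`-parametrisation at the cusp `1/y` is fixed by every `σ ∈ Aut_ℚ(ℂ)` fixing
`ζ_N = e^{2πi/N}` (T-es-75 with `d = d′ = 1`), hence its coordinates lie in `ℚ(ζ_N)` by the fixed-field theorem
(`ComplexAut.mem_adjoin_simple_of_forall_algEquiv`), i.e. it is the base change of a point `P ∈ W(ℚ(ζ_N))`;
(b) GALOIS ACTION — an automorphism `τ` of `ℚ(ζ_N) ⊂ ℂ` with `τ(ζ_N) = ζ_N^d` extends to `σ ∈ Aut_ℚ(ℂ)` (`ComplexAut.exists_complex_algEquiv_extends`,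
Steinitz), and T-es-75 for `σ` gives `τ(P) ↦ u(c·{∞,1/(d′y)}_f)`.

* `optimalGamma1Parametrization_cuspInv_cyclotomic_galois_holds : optimalGamma1Parametrization_cuspInv_cyclotomic_galois`.

HONEST FRAMING.  Discharges the named Literature fact T-es-75♭ (statement-only so far; its hypothesis `D.IsOptimal` is not used).  Nothing about
C2, Manin's conjecture or BSD is proved here; C2 stays OPEN as filed (conditional on CDT).
[cite: Stevens1982, §1.3 Thm. 1.3.1 (a), (b) (p. 13)] [cite: ShimuraIATAF1971, §6.2]
-/

-- lint-debt: the directory name repeats the summit name (sibling precedent `ManinLocalTwoThreeStevensCuspInvGaloisAction.lean`)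
set_option linter.dupNamespace false
set_option autoImplicit false

noncomputable section

open Complex
open scoped Real
open Literature.NumberTheory.EllipticCurves Literature.NumberTheory.EllipticCurves.ModularForms

namespace Summit.BirchSwinnertonDyer.BirchSwinnertonDyer.Theorems.ManinLocalTwoThree.StevensGalois

/-- `ζ_N^d = e^{2πi d/N}` in the shape of the hypothesis of T-es-75. [folklore] -/
private theorem rootOfUnityExp_pow_eq (N d : ℕ) :
    rootOfUnityExp N ^ d = cexp (2 * π * Complex.I * ((d : ℤ) : ℂ) / N) := by
  rw [rootOfUnityExp, ← Complex.exp_nat_mul]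
  congr 1
  push_cast
  ring

/-- **Stevens 1982, Thm. 1.3.1 (a)+(b), cyclotomic form, PROVED** (the named Literature fact
`optimalGamma1Parametrization_cuspInv_cyclotomic_galois`, T-es-75♭): the value of an `X₁(N)`-parametrisation at the cusp `1/y` is
`ℚ(ζ_N)`-rational, and `τ_d : ζ_N ↦ ζ_N^d` maps it to the value at the cusp `1/(d′y)` (`dd′ ≡ 1 (N)`).
[cite: Stevens1982, §1.3 Thm. 1.3.1 (a), (b) (p. 13)] -/
theorem optimalGamma1Parametrization_cuspInv_cyclotomic_galois_holds :
    optimalGamma1Parametrization_cuspInv_cyclotomic_galois := by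
  intro W _ N _ D hopt y hy
  classical
  -- (0) invariance under every `σ` fixing `ζ_N` (T-es-75 with `d = d' = 1`)
  have hfix : ∀ σ : ℂ ≃ₐ[ℚ] ℂ, σ (rootOfUnityExp N) = rootOfUnityExp N →
      WeierstrassCurve.Affine.Point.map (W' := W) (σ : ℂ →ₐ[ℚ] ℂ) (D.uniformize ((D.c : ℂ) * modularSymbol D.f (1 / y))) =
        D.uniformize ((D.c : ℂ) * modularSymbol D.f (1 / y)) := by
    intro σ hσ
    have hσ' : σ (cexp (2 * π * Complex.I / N)) = cexp (2 * π * Complex.I * ((1 : ℤ) : ℂ) / N) := by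
      rw [Int.cast_one, mul_one]; exact hσ
    have h := optimalGamma1Parametrization_cuspInv_galoisAction_holds W D hopt σ 1 1 (by simp) hσ' y hy
    simpa only [Int.cast_one, one_mul] using h
  -- (a) descent of the cusp value to `K = ℚ(ζ_N)`
  have hdesc : ∃ P : (W.baseChange (cyclotomicSubfield N)).toAffine.Point,
      WeierstrassCurve.Affine.Point.baseChange (W' := W) (cyclotomicSubfield N) ℂ P =
        D.uniformize ((D.c : ℂ) * modularSymbol D.f (1 / y)) := by
    rcases hPt : D.uniformize ((D.c : ℂ) * modularSymbol D.f (1 / y)) with _ | ⟨xv, yv, hns⟩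
    · exact ⟨0, rfl⟩
    · have hco : ∀ σ : ℂ ≃ₐ[ℚ] ℂ, σ (rootOfUnityExp N) = rootOfUnityExp N → σ xv = xv ∧ σ yv = yv := by
        intro σ hσ
        have h := hfix σ hσ
        have eσ : ∀ w : ℂ, (σ : ℂ →ₐ[ℚ] ℂ) w = σ w := fun _ ↦ rfl
        rw [hPt, WeierstrassCurve.Affine.Point.map_some] at h
        simpa only [WeierstrassCurve.Affine.Point.some.injEq, eσ] using h
      have hx : xv ∈ cyclotomicSubfield N :=
        ComplexAut.mem_adjoin_simple_of_forall_algEquiv (rootOfUnityExp N) fun σ hσ ↦ (hco σ hσ).1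
      have hyv : yv ∈ cyclotomicSubfield N :=
        ComplexAut.mem_adjoin_simple_of_forall_algEquiv (rootOfUnityExp N) fun σ hσ ↦ (hco σ hσ).2
      have hns' : (W.baseChange (cyclotomicSubfield N)).toAffine.Nonsingular ⟨xv, hx⟩ ⟨yv, hyv⟩ :=
        (WeierstrassCurve.Affine.baseChange_nonsingular (W := W.toAffine) (f := Algebra.ofId (cyclotomicSubfield N) ℂ)
          Subtype.val_injective (⟨xv, hx⟩ : cyclotomicSubfield N) ⟨yv, hyv⟩).mp hns
      exact ⟨WeierstrassCurve.Affine.Point.some _ _ hns', rfl⟩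
  obtain ⟨P, hP⟩ := hdesc
  refine ⟨P, hP, ?_⟩
  -- (b) the Galois action
  intro d d' hdd τ hτ
  obtain ⟨σ, hσ⟩ := ComplexAut.exists_complex_algEquiv_extends (cyclotomicSubfield N) τ
  have hσζ : σ (cexp (2 * π * Complex.I / N)) = cexp (2 * π * Complex.I * ((d : ℤ) : ℂ) / N) := by
    rw [← rootOfUnityExp_pow_eq, ← hτ]
    exact hσ (zetaGen N)
  have hdd' : (((d : ℤ) * d' : ℤ) : ZMod N) = 1 := by
    rw [show (1 : ZMod N) = ((1 : ℤ) : ZMod N) by simp]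
    exact (ZMod.intCast_eq_intCast_iff _ _ _).mpr hdd
  have hT := optimalGamma1Parametrization_cuspInv_galoisAction_holds W D hopt σ (d : ℤ) d' hdd' hσζ y hy
  rw [← hT, ← hP]
  rcases P with _ | ⟨xk, yk, hk⟩
  · rfl
  · change WeierstrassCurve.Affine.Point.map _ (WeierstrassCurve.Affine.Point.map _ _) =
      WeierstrassCurve.Affine.Point.map _ (WeierstrassCurve.Affine.Point.map _ _)
    rw [WeierstrassCurve.Affine.Point.map_some, WeierstrassCurve.Affine.Point.map_some,
      WeierstrassCurve.Affine.Point.map_some, WeierstrassCurve.Affine.Point.map_some]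
    simp only [WeierstrassCurve.Affine.Point.some.injEq]
    exact ⟨(hσ xk).symm, (hσ yk).symm⟩

end Summit.BirchSwinnertonDyer.BirchSwinnertonDyer.Theorems.ManinLocalTwoThree.StevensGalois

end
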